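import Mathlib
import Summits.AtomisticToContinuum.BoseEinsteinCondensation.Theorems.SoloBlindGPScaleCondensation
import Literature.MathematicalPhysics.QuantumManyBody.PeriodicBoseGasCondensationHolds

/-!
# Complete BEC of periodic near-ground states on GP⁺ boxes — unconditional form (K32b)

Wrapper of kernel K32 (`SoloBlindGPScaleCondensation.lean`, solo-blind s78): the named fact
`Fournais2020_condensation` ([Fournais2020, Thm. 1.2]) taken there as the binder `hFou` is PROVED in
the tree (`Fournais2020_condensation_holds`, `PeriodicBoseGasCondensationHolds.lean`); this file
discharges it, so the GP⁺-scale complete-condensation statement for periodic near-ground states holds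
with no named-fact hypothesis (solo-blind s84).

Scope note: the box side is tied to the density by `L = C_L (ρa³)^{-δ} (ρa)^{-1/2}` (GP⁺ regime,
complete BEC for `δ < 1/6`); the thermodynamic-limit statement of the conjunct (`L = (N/ρ)^{1/3}`,
`ρ` fixed) is NOT reached by this file.

## References

* [Fournais2020] S. Fournais, *Length scales for BEC in the dilute Bose gas*, EMS Ser. Congr. Rep. 18
  (2021) 115–133, arXiv:2011.00309: Thm. 1.2.
* [LSSY2005] E. H. Lieb, R. Seiringer, J. P. Solovej, J. Yngvason, *The Mathematics of the Bose Gas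
  and its Condensation*, Birkhäuser 2005: Thm. 2.2 (2.14).
-/

noncomputable section

open MeasureTheory
open scoped ENNReal NNReal

namespace Summit.AtomisticToContinuum.BoseEinsteinCondensation.Theorems

open Literature.MathematicalPhysics.QuantumManyBody.BoseGas

/-- **Complete BEC of periodic near-ground states on GP⁺ boxes, unconditional.**  K32's
`periodicNearGroundState_condensation_gpScale_rate` with [Fournais2020, Thm. 1.2] discharged by the
tree's proof `Fournais2020_condensation_holds`: for measurable repulsive `v` vanishing beyond `R₀`,
`∫ v(|x|)dx < ∞`, `a > 0`, and all `C_L, δ > 0` there are `C, c > 0` with: for `N ≥ 2`,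
`L > max(0, 2R₀)`, `ρa³ ≤ c`, `L = C_L(ρa³)^{-δ}(ρa)^{-1/2}`, every periodic trial state within
`aρ(ρa³)^{1/3}N` of `E₀^per(N,L)` has `N ≤ ⟨Ψ,n₀Ψ⟩ + C·C_L²·(ρa³)^{1/3-2δ}·N`.
[cite: Fournais2020, Thm. 1.2; LSSY2005, Thm. 2.2 (2.14)] -/
theorem periodicNearGroundState_condensation_gpScale_rate_holds
    (v : ℝ → ℝ≥0∞) (hmeas : Measurable v) (R₀ : ℝ) (hR₀ : ∀ r, R₀ < r → v r = 0)
    (hint : (∫⁻ x : Space, v ‖x‖) ≠ ⊤) (hapos : 0 < scatteringLength v)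
    (C_L δ : ℝ) (hC_L : 0 < C_L) (hδ : 0 < δ) :
    ∃ C c : ℝ, 0 < C ∧ 0 < c ∧
      ∀ (N : ℕ) (L : ℝ), 2 ≤ N → 0 < L → 2 * R₀ < L →
        let a := (scatteringLength v).toReal
        let ρ := (N : ℝ) / L ^ 3
        ρ * a ^ 3 ≤ c →
        L = C_L * (ρ * a ^ 3) ^ (-δ) / Real.sqrt (ρ * a) →
        ∀ Ψ : PeriodicTrialState N L,
          periodicEnergy v Ψ ≤ periodicGroundStateEnergy v N L +
              ENNReal.ofReal (a * ρ * (ρ * a ^ 3) ^ ((1:ℝ) / 3) * N) →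
          (N : ℝ≥0∞) ≤ condensateOccupation N L Ψ.ψ +
              ENNReal.ofReal (C * C_L ^ 2 * (ρ * a ^ 3) ^ ((1:ℝ) / 3 - 2 * δ) * N) :=
  periodicNearGroundState_condensation_gpScale_rate Fournais2020_condensation_holds v hmeas R₀ hR₀
    hint hapos C_L δ hC_L hδ

end Summit.AtomisticToContinuum.BoseEinsteinCondensation.Theorems

end
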